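import Summits.Ventures.GridStability.Bench.NE39KsRoaPrep
import HarnessLib

/-!
# «#73-roa» (recast half): from the K-STREAM kernel set «G1.c-NE39-alg-deg2-K» + the nine level inclusions + kernel
# faithfulness to invariance of `{V ≤ γ ≤ 127} ∩ {h = 0}`, the bounds `2κₘ + νₘ² ≤ 1/2`, and `z(t) → 0` FOR THE RECAST
# MODEL M′ = `NE39.field (1/10)` (New England 10-machine classical, lossless pre-fault h12 network, synthetic λ = 1/10)

Cell `gridfusion` (LADDER-GRIDFUSION rung G2.b / K-STREAM G2), seat gridfusion-lyap-2 (g2), OFFER «#73-roa» (HOME STATUS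
2026-08-27T10:2xZ): the region-of-attraction packaging of ★-candidate #73 «G1.c-NE39-alg-deg2-K». INPUTS, all kernel facts
of the tree: (1) sos-5's K-STREAM Main `NE39KsVdotNeg_nonneg` (p520853): `p ≥ 0 on ∩ₘ{gₘ ≥ 0} ∩ {h = 0}`, `p` the
2 976-term claim literal; (2) `NE39KsRoaLie.vdot_linkK`: `p = −lieDeriv (NE39.field (1/10)) V − φ/50` (keyed link,
`Lyapunov/PolyRecastKeyedLie.lean`) and the nine first integrals `hₘ`; (3) `NE39KsDomIncl0…8.domInclₘ`: on
`{V ≤ 127} ∩ {h = 0}`, `2κₘ + νₘ² ≤ 1/2` (B claim a191950b identities `dom_incl_m`, integer Gram lane); (4) lyap-1's bridge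
`Lyapunov.certificate_invariance_tendsto_univ` (p460300) with `M = {h = 0}`, `W = φ/50`. Phase space `Fin 27 → ℝ` read as
the valuation `val z = SOS.vars (List.ofFn z)` (`val z k = z_k` for `k < 27`); variables `(σₘ, κₘ) = (val z (2m),
val z (2m+1))`, `νₘ = val z (18+m)`, m = 0 … 8 ↔ generators 1,3,4,5,6,7,8,9,10 relative to generator 2.

STATEMENT (`roa`): for every `0 < γ ≤ 127` and every solution `z` of `ż = F(z)` on `[0, ∞)` (Mathlib sense: continuous,
right derivative `F (z t)`, `F z i = ((NE39.field (1/10)).getD i []).eval (val z)`) with `z 0 ∈ M = {h₀ = … = h₈ = 0}` and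
`V(z 0) ≤ γ`: `V(z t) ≤ γ` and `2κₘ(t) + νₘ(t)² ≤ 1/2` (all nine m) for all `t ≥ 0`, and `z t → 0`. Obligations discharged
here: `LV ≤ −W` on `M ∩ {V ≤ 127}` (K-STREAM + level inclusions + the `hs`/`gs` literals read on a valuation), `W ≥ 0` on
`M` and `W = 0 ⇒ z = 0` (`2κₘ = σₘ² + κₘ²` on `M`), compactness of `{z ∈ M | V z ≤ 127}` (`‖z‖∞ ≤ 1`), the chain rule and
conservation of `M` (PolyRecast), `V(0) = 0`.

THREE COLUMNS (LADDER-GRIDFUSION). CERTIFIED (kernel, this file + its imports, axioms standard): the statement above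
for the polynomial system M′. MODELLED: M′ = `NE39.field (1/10)` = `RecastData.relField NE39.preLossless (1/10)` (model-1
p467599 / literals `RecastLiteralsNE39`), the relative-speed recast (reference = generator 2, H = 500 s) of the New England
10-machine 39-bus CLASSICAL model, PRE-fault network made LOSSLESS, h12 couplings, unit internal voltages (E6), printed
inertias, and the DECLARED SYNTHETIC uniform damping ratio `λ = D_i/M_i = 1/10` (printed `D = 0`) — MODEL-VALIDITY tokens
«MV-2 + MV-P(k = 8) + MV-λ(1/10) + MV-h12 + MV-E6» (model-2), data custody Row KS (model-4); a census / pipeline object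
(«synthetic uniform damping on the lossless pre-fault New England reduction»), NOT a sentence about the printed system or
about any fault scenario. VALIDATED: nothing here (the SDP solves that located `V` — sos-4 A24 / j263956, j266124; sos-2 B
j267116/j267119 — are provenance of the A/B rows, never the claim). No sentence of this file says a machine or a grid is
stable; «region of attraction» means: the stated set of initial conditions OF THE MODEL M′ is carried to the model's
equilibrium. The return to machine angles and speeds is the sibling `NE39KsRoaModel.lean`.
-/

namespace Summit.Ventures.GridStability.Bench.NE39Ks

open Set Filter Metric Topology Real
open Summit.Ventures.GridStability.Lyapunov Summit.Ventures.GridStability.Models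
open Literature.Computation.Certificates Literature.Computation.Certificates.SOS

noncomputable section

/-! ### Calculus along a solution of the recast system (`Lyapunov/PolyRecast*.lean`) -/

/-- Coordinatewise form of a solution, in the `PolyRecast` vocabulary with the literal field `Flit = NE39.field (1/10)`. [folklore] -/
theorem hasDerivWithinAt_coord {z : ℝ → Fin 27 → ℝ} {t : ℝ} {s : Set ℝ}
    (hz : HasDerivWithinAt z (F (z t)) s t) (i : Fin 27) :
    HasDerivWithinAt (fun τ => z τ i) (Poly.eval (vars (List.ofFn (z t))) (Flit.getD i [])) s t := by
  have h := (hasDerivWithinAt_pi.1 hz) i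
  simp only [F, val, field_eq_Flit] at h
  exact h

/-- **Chain rule**: along a curve with right derivative `F (z t)`, `V ∘ z` has derivative `LV (z t)` — the keyed link `vdot_linkK`. [folklore] -/
theorem hasDerivWithinAt_Vz {z : ℝ → Fin 27 → ℝ} {t : ℝ} {s : Set ℝ}
    (hz : HasDerivWithinAt z (F (z t)) s t) : HasDerivWithinAt (Vz ∘ z) (LVz (z t)) s t :=
  PolyRecast.hasDerivWithinAt_eval_neg_of_lieCheckK (Fp := Flit) (by rw [Flit_length]) vdot_linkK V_numVars
    scalings_pos (hasDerivWithinAt_coord hz)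

/-- `h_0` is conserved along every solution (`h0_isFirstIntegral`). [folklore] -/
theorem hasDerivWithinAt_h0 {z : ℝ → Fin 27 → ℝ} {t : ℝ} {s : Set ℝ} (hz : HasDerivWithinAt z (F (z t)) s t) :
    HasDerivWithinAt (fun τ => Poly.eval (val (z τ)) (hsT.getD 0 [])) 0 s t :=
  PolyRecast.hasDerivWithinAt_eval_zero_of_isZero (Fp := Flit) (by rw [Flit_length]) h0_isFirstIntegral
    (hasDerivWithinAt_coord hz)

/-- `h_1` is conserved along every solution (`h1_isFirstIntegral`). [folklore] -/
theorem hasDerivWithinAt_h1 {z : ℝ → Fin 27 → ℝ} {t : ℝ} {s : Set ℝ} (hz : HasDerivWithinAt z (F (z t)) s t) :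
    HasDerivWithinAt (fun τ => Poly.eval (val (z τ)) (hsT.getD 1 [])) 0 s t :=
  PolyRecast.hasDerivWithinAt_eval_zero_of_isZero (Fp := Flit) (by rw [Flit_length]) h1_isFirstIntegral
    (hasDerivWithinAt_coord hz)

/-- `h_2` is conserved along every solution (`h2_isFirstIntegral`). [folklore] -/
theorem hasDerivWithinAt_h2 {z : ℝ → Fin 27 → ℝ} {t : ℝ} {s : Set ℝ} (hz : HasDerivWithinAt z (F (z t)) s t) :
    HasDerivWithinAt (fun τ => Poly.eval (val (z τ)) (hsT.getD 2 [])) 0 s t :=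
  PolyRecast.hasDerivWithinAt_eval_zero_of_isZero (Fp := Flit) (by rw [Flit_length]) h2_isFirstIntegral
    (hasDerivWithinAt_coord hz)

/-- `h_3` is conserved along every solution (`h3_isFirstIntegral`). [folklore] -/
theorem hasDerivWithinAt_h3 {z : ℝ → Fin 27 → ℝ} {t : ℝ} {s : Set ℝ} (hz : HasDerivWithinAt z (F (z t)) s t) :
    HasDerivWithinAt (fun τ => Poly.eval (val (z τ)) (hsT.getD 3 [])) 0 s t :=
  PolyRecast.hasDerivWithinAt_eval_zero_of_isZero (Fp := Flit) (by rw [Flit_length]) h3_isFirstIntegral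
    (hasDerivWithinAt_coord hz)

/-- `h_4` is conserved along every solution (`h4_isFirstIntegral`). [folklore] -/
theorem hasDerivWithinAt_h4 {z : ℝ → Fin 27 → ℝ} {t : ℝ} {s : Set ℝ} (hz : HasDerivWithinAt z (F (z t)) s t) :
    HasDerivWithinAt (fun τ => Poly.eval (val (z τ)) (hsT.getD 4 [])) 0 s t :=
  PolyRecast.hasDerivWithinAt_eval_zero_of_isZero (Fp := Flit) (by rw [Flit_length]) h4_isFirstIntegral
    (hasDerivWithinAt_coord hz)

/-- `h_5` is conserved along every solution (`h5_isFirstIntegral`). [folklore] -/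
theorem hasDerivWithinAt_h5 {z : ℝ → Fin 27 → ℝ} {t : ℝ} {s : Set ℝ} (hz : HasDerivWithinAt z (F (z t)) s t) :
    HasDerivWithinAt (fun τ => Poly.eval (val (z τ)) (hsT.getD 5 [])) 0 s t :=
  PolyRecast.hasDerivWithinAt_eval_zero_of_isZero (Fp := Flit) (by rw [Flit_length]) h5_isFirstIntegral
    (hasDerivWithinAt_coord hz)

/-- `h_6` is conserved along every solution (`h6_isFirstIntegral`). [folklore] -/
theorem hasDerivWithinAt_h6 {z : ℝ → Fin 27 → ℝ} {t : ℝ} {s : Set ℝ} (hz : HasDerivWithinAt z (F (z t)) s t) :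
    HasDerivWithinAt (fun τ => Poly.eval (val (z τ)) (hsT.getD 6 [])) 0 s t :=
  PolyRecast.hasDerivWithinAt_eval_zero_of_isZero (Fp := Flit) (by rw [Flit_length]) h6_isFirstIntegral
    (hasDerivWithinAt_coord hz)

/-- `h_7` is conserved along every solution (`h7_isFirstIntegral`). [folklore] -/
theorem hasDerivWithinAt_h7 {z : ℝ → Fin 27 → ℝ} {t : ℝ} {s : Set ℝ} (hz : HasDerivWithinAt z (F (z t)) s t) :
    HasDerivWithinAt (fun τ => Poly.eval (val (z τ)) (hsT.getD 7 [])) 0 s t :=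
  PolyRecast.hasDerivWithinAt_eval_zero_of_isZero (Fp := Flit) (by rw [Flit_length]) h7_isFirstIntegral
    (hasDerivWithinAt_coord hz)

/-- `h_8` is conserved along every solution (`h8_isFirstIntegral`). [folklore] -/
theorem hasDerivWithinAt_h8 {z : ℝ → Fin 27 → ℝ} {t : ℝ} {s : Set ℝ} (hz : HasDerivWithinAt z (F (z t)) s t) :
    HasDerivWithinAt (fun τ => Poly.eval (val (z τ)) (hsT.getD 8 [])) 0 s t :=
  PolyRecast.hasDerivWithinAt_eval_zero_of_isZero (Fp := Flit) (by rw [Flit_length]) h8_isFirstIntegral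
    (hasDerivWithinAt_coord hz)

/-- A solution of the recast system starting on `M` stays on `M` (the constraints are first integrals). [folklore] -/
theorem mem_M {z : ℝ → Fin 27 → ℝ} (hzc : ContinuousOn z (Ici 0))
    (hz : ∀ t, 0 ≤ t → HasDerivWithinAt z (F (z t)) (Ici t) t) (h0 : z 0 ∈ M) : ∀ t, 0 ≤ t → z t ∈ M := by
  intro T hT
  have hc : ∀ m : ℕ, ContinuousOn (fun τ => Poly.eval (val (z τ)) (hsT.getD m [])) (Icc 0 T) := fun m =>
    (PolyRecast.continuous_eval_ofFn (hsT.getD m [])).comp_continuousOn (hzc.mono fun s hs => hs.1)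
  have k0 := constant_of_has_deriv_right_zero (hc 0) (fun t ht => hasDerivWithinAt_h0 (hz t ht.1)) T ⟨hT, le_rfl⟩
  have k1 := constant_of_has_deriv_right_zero (hc 1) (fun t ht => hasDerivWithinAt_h1 (hz t ht.1)) T ⟨hT, le_rfl⟩
  have k2 := constant_of_has_deriv_right_zero (hc 2) (fun t ht => hasDerivWithinAt_h2 (hz t ht.1)) T ⟨hT, le_rfl⟩
  have k3 := constant_of_has_deriv_right_zero (hc 3) (fun t ht => hasDerivWithinAt_h3 (hz t ht.1)) T ⟨hT, le_rfl⟩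
  have k4 := constant_of_has_deriv_right_zero (hc 4) (fun t ht => hasDerivWithinAt_h4 (hz t ht.1)) T ⟨hT, le_rfl⟩
  have k5 := constant_of_has_deriv_right_zero (hc 5) (fun t ht => hasDerivWithinAt_h5 (hz t ht.1)) T ⟨hT, le_rfl⟩
  have k6 := constant_of_has_deriv_right_zero (hc 6) (fun t ht => hasDerivWithinAt_h6 (hz t ht.1)) T ⟨hT, le_rfl⟩
  have k7 := constant_of_has_deriv_right_zero (hc 7) (fun t ht => hasDerivWithinAt_h7 (hz t ht.1)) T ⟨hT, le_rfl⟩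
  have k8 := constant_of_has_deriv_right_zero (hc 8) (fun t ht => hasDerivWithinAt_h8 (hz t ht.1)) T ⟨hT, le_rfl⟩
  intro h hh
  have hmem := hh
  simp only [hsT, List.mem_cons, List.not_mem_nil, or_false] at hh
  rcases hh with rfl | rfl | rfl | rfl | rfl | rfl | rfl | rfl | rfl
  · show Poly.eval (val (z T)) (hsT.getD 0 []) = 0
    rw [k0]; exact h0 _ hmem
  · show Poly.eval (val (z T)) (hsT.getD 1 []) = 0
    rw [k1]; exact h0 _ hmem
  · show Poly.eval (val (z T)) (hsT.getD 2 []) = 0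
    rw [k2]; exact h0 _ hmem
  · show Poly.eval (val (z T)) (hsT.getD 3 []) = 0
    rw [k3]; exact h0 _ hmem
  · show Poly.eval (val (z T)) (hsT.getD 4 []) = 0
    rw [k4]; exact h0 _ hmem
  · show Poly.eval (val (z T)) (hsT.getD 5 []) = 0
    rw [k5]; exact h0 _ hmem
  · show Poly.eval (val (z T)) (hsT.getD 6 []) = 0
    rw [k6]; exact h0 _ hmem
  · show Poly.eval (val (z T)) (hsT.getD 7 []) = 0
    rw [k7]; exact h0 _ hmem
  · show Poly.eval (val (z T)) (hsT.getD 8 []) = 0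
    rw [k8]; exact h0 _ hmem

/-! ### The ROA inclusion for the recast model -/

/-- **«#73-roa» (recast coordinates).** MODELLED: the recast polynomial system `ż = F(z)` on `{h = 0}` of M′ =
`NE39.field (1/10)` (see the module docstring). CERTIFIED inputs: K-STREAM Main `NE39KsVdotNeg_nonneg`, the nine level
inclusions `domInclₘ`, the keyed link `vdot_linkK`. STATEMENT: for every level `0 < γ ≤ 127` and every solution `z` on
`[0, ∞)` (continuous, right derivative `F (z t)`) with `z 0 ∈ M`, `V(z 0) ≤ γ`: for all `t ≥ 0`, `V(z t) ≤ γ` and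
`2κₘ(t) + νₘ(t)² ≤ 1/2` for the nine relative angles/speeds (so `κₘ ≤ 1/4`: no relative angle deviation beyond
`arccos(3/4) ≈ 41.4°`, `|νₘ| ≤ 1/√2`), and `z t → 0`. Via `Lyapunov.certificate_invariance_tendsto_univ` (`M = {h = 0}`,
`W = φ/50`). No sentence here says a machine or a grid is stable. [folklore] -/
theorem roa {γ : ℝ} (hγ0 : 0 < γ) (hγ : γ ≤ level) {z : ℝ → Fin 27 → ℝ} (hzc : ContinuousOn z (Ici 0))
    (hz : ∀ t, 0 ≤ t → HasDerivWithinAt z (F (z t)) (Ici t) t) (h0M : z 0 ∈ M) (h0V : Vz (z 0) ≤ γ) :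
    (∀ t, 0 ≤ t → Vz (z t) ≤ γ ∧
        2 * val (z t) 1 + val (z t) 18 ^ 2 ≤ 1 / 2 ∧
        2 * val (z t) 3 + val (z t) 19 ^ 2 ≤ 1 / 2 ∧
        2 * val (z t) 5 + val (z t) 20 ^ 2 ≤ 1 / 2 ∧
        2 * val (z t) 7 + val (z t) 21 ^ 2 ≤ 1 / 2 ∧
        2 * val (z t) 9 + val (z t) 22 ^ 2 ≤ 1 / 2 ∧
        2 * val (z t) 11 + val (z t) 23 ^ 2 ≤ 1 / 2 ∧
        2 * val (z t) 13 + val (z t) 24 ^ 2 ≤ 1 / 2 ∧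
        2 * val (z t) 15 + val (z t) 25 ^ 2 ≤ 1 / 2 ∧
        2 * val (z t) 17 + val (z t) 26 ^ 2 ≤ 1 / 2) ∧
      Tendsto z atTop (𝓝 0) := by
  have hF : Continuous F := continuous_pi fun i => PolyRecast.continuous_eval_ofFn _
  have hV : Continuous Vz := PolyRecast.continuous_eval_ofFn V_poly
  have hW : Continuous Wz := continuous_const.mul (PolyRecast.continuous_eval_ofFn phi_poly)
  have hSγ : IsCompact {y ∈ M | Vz y ≤ γ} :=
    isCompact_S.of_isClosed_subset (isClosed_M.inter (isClosed_le hV continuous_const))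
      (fun y hy => ⟨hy.1, hy.2.trans hγ⟩)
  have hV0 : Vz 0 = 0 := PolyRecast.eval_ofFn_zero_of_all V_poly (by decide +kernel)
  have hφ0 : Poly.eval (val 0) phi_poly = 0 := PolyRecast.eval_ofFn_zero_of_all phi_poly (by decide +kernel)
  have hW0 : Wz 0 = 0 := by unfold Wz; rw [hφ0, mul_zero]
  have hM := mem_M hzc hz h0M
  have h := certificate_invariance_tendsto_univ (M := M) (LV := LVz) (W := Wz) (x₀ := 0) hSγ
    hF.continuousOn hV.continuousOn hW.continuousOn
    (fun y hy hVy => LVz_le hy (hVy.trans hγ)) (fun y hy _ => Wz_nonneg hy) (fun y hy hVy => Wz_pos hγ0 hy hVy)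
    zero_mem_M (by rw [hV0]; exact hγ0.le) hW0 (fun y hy _ hWy => eq_zero_of_Wz hy hWy)
    hzc hz (fun t ht => hasDerivWithinAt_Vz (hz t ht)) hM h0V
  refine ⟨fun t ht => ?_, h.2⟩
  have hVt : Poly.eval (val (z t)) V_poly ≤ 127 := (h.1 t ht).trans hγ
  exact ⟨h.1 t ht, domIncl0 (val (z t)) hVt (hM t ht), domIncl1 (val (z t)) hVt (hM t ht), domIncl2 (val (z t)) hVt (hM t ht), domIncl3 (val (z t)) hVt (hM t ht), domIncl4 (val (z t)) hVt (hM t ht), domIncl5 (val (z t)) hVt (hM t ht), domIncl6 (val (z t)) hVt (hM t ht), domIncl7 (val (z t)) hVt (hM t ht), domIncl8 (val (z t)) hVt (hM t ht)⟩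

end

end Summit.Ventures.GridStability.Bench.NE39Ks
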